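import Mathlib.Analysis.SpecialFunctions.Pow.Real
import Mathlib.Analysis.SpecificLimits.Normed
import Mathlib.Algebra.Order.Field.GeomSum
import Summits.CriticalPhenomena.SAWScalingLimit.Theorems.SAWDefectDecoherenceTipMartingaleDefs
import HarnessLib

/-!
# Scale induction for the line `tip-martingale-depth-induction`
(crux `SAWDefectDecoherence.DefectDecoherence`, stmt-CriticalPhenomena-8549;
stub `stub_scaleInduction`)

Pure real analysis: a Fekete-type induction over dyadic depth blocks.  Given an abstract depth-bound
predicate `D R b` monotone in `b`, a crude bound `B₀` at every depth `≥ 1`, and the telescoped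
one-step recursion `RecursionStep D (fun m => cα * m ^ (-α)) c β B₀` of the vocabulary file
`SAWDefectDecoherenceTipMartingaleDefs` (mixing profile `cα m^{-α}`, exit exponent `β`, both
exponents `> 3/4`), we produce `C` and `θ > 3/4` with `D R (C R^{-θ})` for every `R ≥ 1`.

Outline.  Fix `3/4 < θ < m := min α β`.  The strata cost obeys
`strataSum c β B₀ r N η C ≤ c C^{-β} (A r^{-θ}) K₂` as soon as `η ≤ A ρ^{-θ}` on the strata
depths (`tm_strataSum_le`, a geometric series); with entrance radius `r = R/2^{J+1}` and
picture scales `2r·2^i` one telescoped step then costs at most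
`(cα + cK₂ + cα c K₂ J)(2^J)^{-m} · A r^{-θ}` (`tm_etaNew_le`), and `J` is chosen once and for
all with `(cα + cK₂ + cα c K₂ J)(2^J)^{-m} ≤ (2^{J+1})^{-θ}` (`tm_exists_doublings`, since
`J 2^{-J(m-θ)} → 0`), which is exactly `A r^{-θ} ↦ A R^{-θ}`.  The induction runs over the
blocks `R < 2^n 2^{J+1}` with `C = B₀ (2^{J+1})^θ`.  No walks, no lattice: `D` is abstract.
Deliberately NOT here: the other stubs of the line (orbit mixing, wall exit, telescoping recursion).
-/

namespace Summit.CriticalPhenomena.SAWScalingLimit.Theorems.DefectDecoherence.TipMartingale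

open scoped BigOperators

/-- `(2^j)^s = 2^{j s}` for a natural `j` and a real `s` (mixed `npow`/`rpow` bookkeeping).
[folklore] -/
theorem tm_two_pow_rpow (j : ℕ) (s : ℝ) : ((2:ℝ) ^ j) ^ s = (2:ℝ) ^ ((j:ℝ) * s) :=
  (Real.rpow_natCast_mul (by norm_num) j s).symm

/-- **Choice of the number of doublings.**  For `θ < m` and any `L₀, L₁` there is `J : ℕ`
with `(L₀ + L₁ J) (2^J)^{-m} ≤ (2^{J+1})^{-θ}`, because `J · 2^{-J(m-θ)} → 0`. [folklore] -/
theorem tm_exists_doublings (L₀ L₁ m θ : ℝ) (hθm : θ < m) :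
    ∃ J : ℕ, (L₀ + L₁ * J) * ((2:ℝ) ^ J) ^ (-m) ≤ ((2:ℝ) ^ (J + 1)) ^ (-θ) := by
  have hq0 : (0:ℝ) ≤ (2:ℝ) ^ (θ - m) := Real.rpow_nonneg (by norm_num) _
  have hq1 : (2:ℝ) ^ (θ - m) < 1 := Real.rpow_lt_one_of_one_lt_of_neg (by norm_num) (by linarith)
  have hε : (0:ℝ) < (2:ℝ) ^ (-θ) := Real.rpow_pos_of_pos (by norm_num) _
  have h := ((tendsto_pow_atTop_nhds_zero_of_lt_one hq0 hq1).const_mul L₀).add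
    ((tendsto_self_mul_const_pow_of_lt_one hq0 hq1).const_mul L₁)
  simp only [mul_zero, add_zero] at h
  obtain ⟨J, hJ⟩ := (h.eventually (gt_mem_nhds hε)).exists
  refine ⟨J, ?_⟩
  have h2J : (0:ℝ) ≤ (2:ℝ) ^ J := by positivity
  have hsplit : ((2:ℝ) ^ J) ^ (-m) = ((2:ℝ) ^ (θ - m)) ^ J * ((2:ℝ) ^ J) ^ (-θ) := by
    rw [tm_two_pow_rpow, tm_two_pow_rpow, ← Real.rpow_mul_natCast (by norm_num : (0:ℝ) ≤ 2),
      ← Real.rpow_add (by norm_num : (0:ℝ) < 2)]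
    congr 1; ring
  have hsucc : ((2:ℝ) ^ (J + 1)) ^ (-θ) = (2:ℝ) ^ (-θ) * ((2:ℝ) ^ J) ^ (-θ) := by
    rw [pow_succ, Real.mul_rpow h2J (by norm_num : (0:ℝ) ≤ 2), mul_comm]
  rw [hsplit, hsucc]
  calc (L₀ + L₁ * J) * (((2:ℝ) ^ (θ - m)) ^ J * ((2:ℝ) ^ J) ^ (-θ))
      = (L₀ * ((2:ℝ) ^ (θ - m)) ^ J + L₁ * ((J:ℝ) * ((2:ℝ) ^ (θ - m)) ^ J)) *
          ((2:ℝ) ^ J) ^ (-θ) := by ring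
    _ ≤ (2:ℝ) ^ (-θ) * ((2:ℝ) ^ J) ^ (-θ) :=
        mul_le_mul_of_nonneg_right hJ.le (Real.rpow_nonneg h2J _)

/-- **Strata bound.**  For `0 < θ < β` there is `K₂ ≥ 0` (namely `2^θ/(1-2^{θ-β}) + 2^β`)
such that whenever the profile satisfies `η(r/2^{j+1}) ≤ A (r/2^{j+1})^{-θ}` on the strata
depths (`j < N`, `r/2^N < 2`, `r ≥ 1`, `0 ≤ B₀ ≤ A`),
`strataSum c β B₀ r N η C ≤ c C^{-β} (A r^{-θ}) K₂`: a geometric sum for the strata and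
`2^{-Nβ} ≤ 2^β r^{-θ}` for the crude last stratum. [folklore] -/
theorem tm_strataSum_le {θ β : ℝ} (hθ : 0 < θ) (hθβ : θ < β) :
    ∃ K₂ : ℝ, 0 ≤ K₂ ∧ ∀ (c B₀ A r C : ℝ) (N : ℕ) (η : ℝ → ℝ), 0 ≤ c → 0 ≤ B₀ → B₀ ≤ A →
      1 ≤ r → r / 2 ^ N < 2 → 0 < C →
      (∀ j < N, η (r / 2 ^ (j + 1)) ≤ A * (r / 2 ^ (j + 1)) ^ (-θ)) →
      strataSum c β B₀ r N η C ≤ c * C ^ (-β) * (A * r ^ (-θ)) * K₂ := by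
  have hq0 : (0:ℝ) ≤ (2:ℝ) ^ (θ - β) := Real.rpow_nonneg (by norm_num) _
  have hq1 : (2:ℝ) ^ (θ - β) < 1 := Real.rpow_lt_one_of_one_lt_of_neg (by norm_num) (by linarith)
  have h2θ : (0:ℝ) ≤ (2:ℝ) ^ θ := Real.rpow_nonneg (by norm_num) _
  have h2β : (0:ℝ) ≤ (2:ℝ) ^ β := Real.rpow_nonneg (by norm_num) _
  have hgeom : ∀ N : ℕ, ∑ j ∈ Finset.range N, ((2:ℝ) ^ (θ - β)) ^ j ≤ (1 - (2:ℝ) ^ (θ - β))⁻¹ := by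
    intro N
    have h := geom_sum_Ico_le_of_lt_one (m := 0) (n := N) hq0 hq1
    rwa [pow_zero, one_div, ← Finset.range_eq_Ico] at h
  refine ⟨(2:ℝ) ^ θ * (1 - (2:ℝ) ^ (θ - β))⁻¹ + (2:ℝ) ^ β,
    add_nonneg (mul_nonneg h2θ (inv_nonneg.mpr (sub_nonneg.mpr hq1.le))) h2β, ?_⟩
  intro c B₀ A r C N η hc hB₀ hBA hr hrN hC hη
  have hA : 0 ≤ A := hB₀.trans hBA
  have hr0 : 0 < r := by linarith
  have hCβ : 0 ≤ C ^ (-β) := Real.rpow_nonneg hC.le _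
  -- the strata `j < N`
  have hS : ∑ j ∈ Finset.range N, (C * 2 ^ j) ^ (-β) * η (r / 2 ^ (j + 1)) ≤
      C ^ (-β) * (A * r ^ (-θ)) * ((2:ℝ) ^ θ * (1 - (2:ℝ) ^ (θ - β))⁻¹) := by
    calc ∑ j ∈ Finset.range N, (C * 2 ^ j) ^ (-β) * η (r / 2 ^ (j + 1))
        ≤ ∑ j ∈ Finset.range N, (C * 2 ^ j) ^ (-β) * (A * (r / 2 ^ (j + 1)) ^ (-θ)) := by
          refine Finset.sum_le_sum fun j hj => ?_
          exact mul_le_mul_of_nonneg_left (hη j (Finset.mem_range.1 hj))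
            (Real.rpow_nonneg (by positivity) _)
      _ = ∑ j ∈ Finset.range N, C ^ (-β) * (A * r ^ (-θ)) * (2:ℝ) ^ θ * ((2:ℝ) ^ (θ - β)) ^ j := by
          refine Finset.sum_congr rfl fun j _ => ?_
          have e1 : (C * 2 ^ j) ^ (-β) = C ^ (-β) * (2:ℝ) ^ ((j:ℝ) * (-β)) := by
            rw [Real.mul_rpow hC.le (by positivity : (0:ℝ) ≤ 2 ^ j), tm_two_pow_rpow]
          have e2 : (r / 2 ^ (j + 1)) ^ (-θ) = r ^ (-θ) * (2:ℝ) ^ (((j:ℝ) + 1) * θ) := by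
            rw [Real.div_rpow hr0.le (by positivity : (0:ℝ) ≤ 2 ^ (j + 1)), tm_two_pow_rpow,
              Nat.cast_succ, show ((j:ℝ) + 1) * -θ = -(((j:ℝ) + 1) * θ) by ring,
              Real.rpow_neg (by norm_num : (0:ℝ) ≤ 2), div_inv_eq_mul]
          have e3 : (2:ℝ) ^ ((j:ℝ) * (-β)) * (2:ℝ) ^ (((j:ℝ) + 1) * θ) =
              (2:ℝ) ^ θ * ((2:ℝ) ^ (θ - β)) ^ j := by
            rw [← Real.rpow_add (by norm_num : (0:ℝ) < 2),
              ← Real.rpow_mul_natCast (by norm_num : (0:ℝ) ≤ 2),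
              ← Real.rpow_add (by norm_num : (0:ℝ) < 2)]
            congr 1; ring
          rw [e1, e2]
          calc C ^ (-β) * (2:ℝ) ^ ((j:ℝ) * (-β)) * (A * (r ^ (-θ) * (2:ℝ) ^ (((j:ℝ) + 1) * θ)))
              = C ^ (-β) * (A * r ^ (-θ)) *
                  ((2:ℝ) ^ ((j:ℝ) * (-β)) * (2:ℝ) ^ (((j:ℝ) + 1) * θ)) := by ring
            _ = C ^ (-β) * (A * r ^ (-θ)) * ((2:ℝ) ^ θ * ((2:ℝ) ^ (θ - β)) ^ j) := by rw [e3]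
            _ = _ := by ring
      _ = C ^ (-β) * (A * r ^ (-θ)) * (2:ℝ) ^ θ * ∑ j ∈ Finset.range N, ((2:ℝ) ^ (θ - β)) ^ j := by
          rw [Finset.mul_sum]
      _ ≤ C ^ (-β) * (A * r ^ (-θ)) * (2:ℝ) ^ θ * (1 - (2:ℝ) ^ (θ - β))⁻¹ :=
          mul_le_mul_of_nonneg_left (hgeom N) (by positivity)
      _ = _ := by ring
  -- the crude last stratum
  have hT : (C * 2 ^ N) ^ (-β) * B₀ ≤ C ^ (-β) * (A * r ^ (-θ)) * (2:ℝ) ^ β := by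
    have h2N : r / 2 ≤ 2 ^ N := by
      rw [div_lt_iff₀ (by positivity)] at hrN; linarith
    have hNβ : ((2:ℝ) ^ N) ^ (-β) ≤ r ^ (-θ) * (2:ℝ) ^ β := by
      calc ((2:ℝ) ^ N) ^ (-β) ≤ (r / 2) ^ (-β) :=
            Real.rpow_le_rpow_of_nonpos (by positivity) h2N (by linarith)
        _ = r ^ (-β) * (2:ℝ) ^ β := by
            rw [Real.div_rpow hr0.le (by norm_num : (0:ℝ) ≤ 2),
              Real.rpow_neg (by norm_num : (0:ℝ) ≤ 2), div_inv_eq_mul]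
        _ ≤ r ^ (-θ) * (2:ℝ) ^ β :=
            mul_le_mul_of_nonneg_right (Real.rpow_le_rpow_of_exponent_le hr (by linarith)) h2β
    rw [Real.mul_rpow hC.le (by positivity : (0:ℝ) ≤ 2 ^ N)]
    calc C ^ (-β) * ((2:ℝ) ^ N) ^ (-β) * B₀ ≤ C ^ (-β) * (r ^ (-θ) * (2:ℝ) ^ β) * A :=
          mul_le_mul (mul_le_mul_of_nonneg_left hNβ hCβ) hBA hB₀ (by positivity)
      _ = _ := by ring
  unfold strataSum
  calc c * ((∑ j ∈ Finset.range N, (C * 2 ^ j) ^ (-β) * η (r / 2 ^ (j + 1))) +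
        (C * 2 ^ N) ^ (-β) * B₀)
      ≤ c * (C ^ (-β) * (A * r ^ (-θ)) * ((2:ℝ) ^ θ * (1 - (2:ℝ) ^ (θ - β))⁻¹) +
          C ^ (-β) * (A * r ^ (-θ)) * (2:ℝ) ^ β) :=
        mul_le_mul_of_nonneg_left (add_le_add hS hT) hc
    _ = _ := by ring


/-- **One telescoped step, evaluated.**  With `s₀ = 2r` and `R = r 2^{J+1}` (so `R/s₀ = 2^J`,
`R/(s₀2^{i+1}) = 2^J/2^{i+1}`, `s₀2^i/r = 2^{i+1}`), a profile with `η r ≤ A r^{-θ}` and the strata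
bound of `tm_strataSum_le` give
`etaNew ≤ (cα + c K₂ + cα c K₂ J) (2^J)^{-m} (A r^{-θ})` for any `0 ≤ m ≤ min α β`. [folklore] -/
theorem tm_etaNew_le {cα α c β B₀ θ m A K₂ R r s₀ : ℝ} {J N : ℕ} {η : ℝ → ℝ}
    (hcα : 0 ≤ cα) (hc : 0 ≤ c) (hK₂ : 0 ≤ K₂) (hA : 0 ≤ A) (hm : 0 ≤ m) (hmα : m ≤ α)
    (hmβ : m ≤ β) (hr : 0 < r) (h1 : R / s₀ = 2 ^ J)
    (h2 : ∀ i : ℕ, R / (s₀ * 2 ^ (i + 1)) = 2 ^ J / 2 ^ (i + 1))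
    (h3 : ∀ i : ℕ, s₀ * 2 ^ i / r = 2 ^ (i + 1)) (hηr : η r ≤ A * r ^ (-θ))
    (hstrata : ∀ C : ℝ, 0 < C → strataSum c β B₀ r N η C ≤ c * C ^ (-β) * (A * r ^ (-θ)) * K₂) :
    etaNew (fun x => cα * x ^ (-α)) c β B₀ η R r s₀ J N ≤
      (cα + c * K₂ + cα * c * K₂ * J) * ((2:ℝ) ^ J) ^ (-m) * (A * r ^ (-θ)) := by
  have h2J : (1:ℝ) ≤ 2 ^ J := one_le_pow₀ (by norm_num)
  have hArθ : 0 ≤ A * r ^ (-θ) := mul_nonneg hA (Real.rpow_nonneg hr.le _)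
  have hE : etaNew (fun x => cα * x ^ (-α)) c β B₀ η R r s₀ J N =
      cα * ((2:ℝ) ^ J) ^ (-α) * η r +
      (∑ i ∈ Finset.range J, cα * ((2:ℝ) ^ J / 2 ^ (i + 1)) ^ (-α) *
        strataSum c β B₀ r N η (2 ^ (i + 1))) +
      strataSum c β B₀ r N η (2 ^ (J + 1)) := by
    simp only [etaNew, h1, h2, h3]
  -- the entrance term
  have hT1 : cα * ((2:ℝ) ^ J) ^ (-α) * η r ≤ cα * ((2:ℝ) ^ J) ^ (-m) * (A * r ^ (-θ)) :=
    calc cα * ((2:ℝ) ^ J) ^ (-α) * η r ≤ cα * ((2:ℝ) ^ J) ^ (-α) * (A * r ^ (-θ)) :=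
          mul_le_mul_of_nonneg_left hηr (by positivity)
      _ ≤ cα * ((2:ℝ) ^ J) ^ (-m) * (A * r ^ (-θ)) :=
          mul_le_mul_of_nonneg_right
            (mul_le_mul_of_nonneg_left (Real.rpow_le_rpow_of_exponent_le h2J (by linarith)) hcα)
            hArθ
  -- the intermediate picture scales
  have hT2 : ∑ i ∈ Finset.range J, cα * ((2:ℝ) ^ J / 2 ^ (i + 1)) ^ (-α) *
        strataSum c β B₀ r N η (2 ^ (i + 1)) ≤
      J * (cα * c * K₂ * ((2:ℝ) ^ J) ^ (-m) * (A * r ^ (-θ))) := by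
    have key : ∀ i ∈ Finset.range J, cα * ((2:ℝ) ^ J / 2 ^ (i + 1)) ^ (-α) *
        strataSum c β B₀ r N η (2 ^ (i + 1)) ≤
        cα * c * K₂ * ((2:ℝ) ^ J) ^ (-m) * (A * r ^ (-θ)) := by
      intro i hi
      have hi' : i + 1 ≤ J := Finset.mem_range.1 hi
      have hx1 : (1:ℝ) ≤ 2 ^ J / 2 ^ (i + 1) := by
        rw [le_div_iff₀ (by positivity), one_mul]
        exact pow_le_pow_right₀ (by norm_num) hi'
      have hy1 : (1:ℝ) ≤ 2 ^ (i + 1) := one_le_pow₀ (by norm_num)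
      have hxα : ((2:ℝ) ^ J / 2 ^ (i + 1)) ^ (-α) ≤ ((2:ℝ) ^ J / 2 ^ (i + 1)) ^ (-m) :=
        Real.rpow_le_rpow_of_exponent_le hx1 (by linarith)
      have hyβ : ((2:ℝ) ^ (i + 1)) ^ (-β) ≤ ((2:ℝ) ^ (i + 1)) ^ (-m) :=
        Real.rpow_le_rpow_of_exponent_le hy1 (by linarith)
      have hxy : ((2:ℝ) ^ J / 2 ^ (i + 1)) ^ (-m) * ((2:ℝ) ^ (i + 1)) ^ (-m) =
          ((2:ℝ) ^ J) ^ (-m) := by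
        rw [← Real.mul_rpow (by positivity : (0:ℝ) ≤ 2 ^ J / 2 ^ (i + 1))
          (by positivity : (0:ℝ) ≤ 2 ^ (i + 1)),
          div_mul_cancel₀ _ (by positivity : (2:ℝ) ^ (i + 1) ≠ 0)]
      have hs' : strataSum c β B₀ r N η (2 ^ (i + 1)) ≤
          c * ((2:ℝ) ^ (i + 1)) ^ (-m) * (A * r ^ (-θ)) * K₂ :=
        (hstrata (2 ^ (i + 1)) (by positivity)).trans
          (mul_le_mul_of_nonneg_right
            (mul_le_mul_of_nonneg_right (mul_le_mul_of_nonneg_left hyβ hc) hArθ) hK₂)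
      calc cα * ((2:ℝ) ^ J / 2 ^ (i + 1)) ^ (-α) * strataSum c β B₀ r N η (2 ^ (i + 1))
          ≤ cα * ((2:ℝ) ^ J / 2 ^ (i + 1)) ^ (-α) *
              (c * ((2:ℝ) ^ (i + 1)) ^ (-m) * (A * r ^ (-θ)) * K₂) :=
            mul_le_mul_of_nonneg_left hs' (by positivity)
        _ ≤ cα * ((2:ℝ) ^ J / 2 ^ (i + 1)) ^ (-m) *
              (c * ((2:ℝ) ^ (i + 1)) ^ (-m) * (A * r ^ (-θ)) * K₂) :=
            mul_le_mul_of_nonneg_right (mul_le_mul_of_nonneg_left hxα hcα) (by positivity)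
        _ = cα * c * K₂ * (((2:ℝ) ^ J / 2 ^ (i + 1)) ^ (-m) * ((2:ℝ) ^ (i + 1)) ^ (-m)) *
              (A * r ^ (-θ)) := by ring
        _ = _ := by rw [hxy]
    calc _ ≤ ∑ i ∈ Finset.range J, cα * c * K₂ * ((2:ℝ) ^ J) ^ (-m) * (A * r ^ (-θ)) :=
          Finset.sum_le_sum key
      _ = _ := by rw [Finset.sum_const, Finset.card_range, nsmul_eq_mul]
  -- the last picture scale
  have hT3 : strataSum c β B₀ r N η (2 ^ (J + 1)) ≤
      c * K₂ * ((2:ℝ) ^ J) ^ (-m) * (A * r ^ (-θ)) := by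
    have hy : ((2:ℝ) ^ (J + 1)) ^ (-β) ≤ ((2:ℝ) ^ J) ^ (-m) :=
      calc ((2:ℝ) ^ (J + 1)) ^ (-β) ≤ ((2:ℝ) ^ (J + 1)) ^ (-m) :=
            Real.rpow_le_rpow_of_exponent_le (one_le_pow₀ (by norm_num)) (by linarith)
        _ ≤ ((2:ℝ) ^ J) ^ (-m) :=
            Real.rpow_le_rpow_of_nonpos (by positivity)
              (pow_le_pow_right₀ (by norm_num) (Nat.le_succ J)) (by linarith)
    calc strataSum c β B₀ r N η (2 ^ (J + 1))
        ≤ c * ((2:ℝ) ^ (J + 1)) ^ (-β) * (A * r ^ (-θ)) * K₂ := hstrata _ (by positivity)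
      _ ≤ c * ((2:ℝ) ^ J) ^ (-m) * (A * r ^ (-θ)) * K₂ :=
          mul_le_mul_of_nonneg_right
            (mul_le_mul_of_nonneg_right (mul_le_mul_of_nonneg_left hy hc) hArθ) hK₂
      _ = _ := by ring
  rw [hE]
  calc _ ≤ cα * ((2:ℝ) ^ J) ^ (-m) * (A * r ^ (-θ)) +
        J * (cα * c * K₂ * ((2:ℝ) ^ J) ^ (-m) * (A * r ^ (-θ))) +
        c * K₂ * ((2:ℝ) ^ J) ^ (-m) * (A * r ^ (-θ)) := add_le_add (add_le_add hT1 hT2) hT3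
    _ = _ := by ring

/-- **Scale induction (stub `stub_scaleInduction` of the line `tip-martingale-depth-induction`).**
For a depth-bound predicate `D` monotone in the bound, a base bound `B₀ ≥ 0` valid at every depth
`≥ 1`, and the telescoped one-step recursion `RecursionStep D (cα m^{-α}) c β B₀` with
`α, β > 3/4`, there are `C` and `θ > 3/4` with `D R (C R^{-θ})` for all `R ≥ 1`.
Proof: Fekete-type induction over the dyadic depth blocks `[2^n K₀, 2^{n+1} K₀)`, `K₀ = 2^{J+1}`,
with `θ` strictly between `3/4` and `min α β`, `J` from `tm_exists_doublings`, `C = B₀ K₀^θ`, and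
the profile `η ρ = C ρ^{-θ}` below `2^n K₀`, `B₀` above. [folklore] -/
theorem stub_scaleInduction :
    ∀ (D : ℝ → ℝ → Prop) (cα α c β B₀ : ℝ),
      (∀ R b b', b ≤ b' → D R b → D R b') → 3 / 4 < α → 3 / 4 < β → 0 ≤ cα → 0 ≤ c → 0 ≤ B₀ →
      (∀ ρ, 1 ≤ ρ → D ρ B₀) → RecursionStep D (fun m => cα * m ^ (-α)) c β B₀ →
      ∃ C θ : ℝ, 3 / 4 < θ ∧ ∀ R, 1 ≤ R → D R (C * R ^ (-θ)) := by
  intro D cα α c β B₀ hmono hα hβ hcα hc hB₀ hbase hstep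
  unfold RecursionStep at hstep
  -- exponents `3/4 < θ < m = min α β`
  obtain ⟨m, hmα, hmβ, hm34⟩ : ∃ m : ℝ, m ≤ α ∧ m ≤ β ∧ 3 / 4 < m :=
    ⟨min α β, min_le_left _ _, min_le_right _ _, lt_min hα hβ⟩
  obtain ⟨θ, hθ34, hθm⟩ : ∃ θ : ℝ, 3 / 4 < θ ∧ θ < m := ⟨(3 / 4 + m) / 2, by linarith, by linarith⟩
  have hθ0 : 0 < θ := by linarith
  have hm0 : 0 ≤ m := by linarith
  -- constants: strata constant `K₂`, number of doublings `J`, `K₀ = 2^{J+1}`, `A = B₀ K₀^θ`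
  obtain ⟨K₂, hK₂, hstrata⟩ := tm_strataSum_le hθ0 (hθm.trans_le hmβ)
  obtain ⟨J, hJ⟩ := tm_exists_doublings (cα + c * K₂) (cα * c * K₂) m θ hθm
  obtain ⟨K₀, hK₀_def⟩ : ∃ K₀ : ℝ, K₀ = 2 ^ (J + 1) := ⟨_, rfl⟩
  have hK₀1 : (1:ℝ) ≤ K₀ := hK₀_def ▸ one_le_pow₀ (by norm_num)
  have hK₀2 : (2:ℝ) ≤ K₀ := by
    rw [hK₀_def, pow_succ]
    exact le_mul_of_one_le_left (by norm_num) (one_le_pow₀ (by norm_num))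
  have hK₀pos : (0:ℝ) < K₀ := by linarith
  obtain ⟨A, hA_def⟩ : ∃ A : ℝ, A = B₀ * K₀ ^ θ := ⟨_, rfl⟩
  have hBA : B₀ ≤ A := hA_def ▸ le_mul_of_one_le_right hB₀ (Real.one_le_rpow hK₀1 hθ0.le)
  have hA0 : 0 ≤ A := hB₀.trans hBA
  -- the claim, by induction over dyadic blocks
  have claim : ∀ n : ℕ, ∀ R : ℝ, 1 ≤ R → R < 2 ^ n * K₀ → D R (A * R ^ (-θ)) := by
    intro n
    induction n with
    | zero =>
      intro R hR1 hRK
      rw [pow_zero, one_mul] at hRK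
      have hR0 : 0 < R := by linarith
      refine hmono R _ _ ?_ (hbase R hR1)
      have h1 : 1 ≤ K₀ ^ θ * R ^ (-θ) := by
        rw [Real.rpow_neg hR0.le, ← div_eq_mul_inv, one_le_div (Real.rpow_pos_of_pos hR0 _)]
        exact Real.rpow_le_rpow hR0.le hRK.le hθ0.le
      calc B₀ = B₀ * 1 := (mul_one _).symm
        _ ≤ B₀ * (K₀ ^ θ * R ^ (-θ)) := mul_le_mul_of_nonneg_left h1 hB₀
        _ = A * R ^ (-θ) := by rw [hA_def, mul_assoc]
    | succ n ih =>
      intro R hR1 hRK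
      by_cases hlt : R < 2 ^ n * K₀
      · exact ih R hR1 hlt
      rw [not_lt] at hlt
      have h2n : (0:ℝ) < 2 ^ n := by positivity
      -- entrance radius `r = R / 2^{J+1} ∈ [2^n, 2^{n+1})`, `N = n`, `s₀ = 2r`
      obtain ⟨r, hr_def⟩ : ∃ r : ℝ, r = R / K₀ := ⟨_, rfl⟩
      have hRr : R = r * K₀ := by rw [hr_def, div_mul_cancel₀ R hK₀pos.ne']
      have hrlo : 2 ^ n ≤ r := by rw [hr_def, le_div_iff₀ hK₀pos]; exact hlt
      have hrhi : r < 2 ^ (n + 1) := by rw [hr_def, div_lt_iff₀ hK₀pos]; exact hRK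
      have hr1 : 1 ≤ r := (one_le_pow₀ (by norm_num)).trans hrlo
      have hr0 : 0 < r := by linarith
      have hrK : r < 2 ^ n * K₀ :=
        calc r < 2 ^ (n + 1) := hrhi
          _ = 2 ^ n * 2 := pow_succ _ _
          _ ≤ 2 ^ n * K₀ := mul_le_mul_of_nonneg_left hK₀2 h2n.le
      have hN1 : 1 ≤ r / 2 ^ n := by rwa [le_div_iff₀ h2n, one_mul]
      have hN2 : r / 2 ^ n < 2 := by
        rw [div_lt_iff₀ h2n]; rw [pow_succ] at hrhi; linarith
      have hs : r + 1 ≤ 2 * r := by linarith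
      have hRJ : 2 * r * 2 ^ J ≤ R := le_of_eq (by rw [hRr, hK₀_def]; ring)
      -- the profile
      obtain ⟨η, hη⟩ : ∃ η : ℝ → ℝ, ∀ ρ, η ρ =
          if 1 ≤ ρ ∧ ρ < 2 ^ n * K₀ then A * ρ ^ (-θ) else B₀ := ⟨_, fun ρ => rfl⟩
      have hη0 : ∀ ρ, 0 ≤ η ρ := by
        intro ρ
        rw [hη]
        split_ifs with h
        · exact mul_nonneg hA0 (Real.rpow_nonneg (by linarith [h.1]) _)
        · exact hB₀
      have hηD : ∀ ρ, 1 ≤ ρ → D ρ (η ρ) := by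
        intro ρ hρ
        rw [hη]
        split_ifs with h
        · exact ih ρ hρ h.2
        · exact hbase ρ hρ
      have hηeq : ∀ ρ, 1 ≤ ρ → ρ < 2 ^ n * K₀ → η ρ = A * ρ ^ (-θ) := fun ρ hρ1 hρ2 => by
        rw [hη, if_pos ⟨hρ1, hρ2⟩]
      -- one telescoped step
      have hD := hstep η hη0 hηD R r (2 * r) J n hN1 hN2 hs hRJ
      refine hmono R _ _ ?_ hD
      have h1 : R / (2 * r) = 2 ^ J := by
        rw [div_eq_iff (by positivity), hRr, hK₀_def]; ring
      have h2 : ∀ i : ℕ, R / (2 * r * 2 ^ (i + 1)) = 2 ^ J / 2 ^ (i + 1) := by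
        intro i
        rw [div_eq_div_iff (by positivity) (by positivity), hRr, hK₀_def]; ring
      have h3 : ∀ i : ℕ, 2 * r * 2 ^ i / r = 2 ^ (i + 1) := by
        intro i
        rw [div_eq_iff hr0.ne']; ring
      have hstr : ∀ C : ℝ, 0 < C →
          strataSum c β B₀ r n η C ≤ c * C ^ (-β) * (A * r ^ (-θ)) * K₂ := by
        intro C hC
        refine hstrata c B₀ A r C n η hc hB₀ hBA hr1 hN2 hC fun j hj => (hηeq _ ?_ ?_).le
        · rw [le_div_iff₀ (by positivity), one_mul]
          exact (pow_le_pow_right₀ (by norm_num) (Nat.succ_le_of_lt hj)).trans hrlo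
        · exact (div_le_self hr0.le (one_le_pow₀ (by norm_num))).trans_lt hrK
      calc etaNew (fun m => cα * m ^ (-α)) c β B₀ η R r (2 * r) J n
          ≤ (cα + c * K₂ + cα * c * K₂ * J) * ((2:ℝ) ^ J) ^ (-m) * (A * r ^ (-θ)) :=
            tm_etaNew_le hcα hc hK₂ hA0 hm0 hmα hmβ hr0 h1 h2 h3 (hηeq r hr1 hrK).le hstr
        _ ≤ ((2:ℝ) ^ (J + 1)) ^ (-θ) * (A * r ^ (-θ)) :=
            mul_le_mul_of_nonneg_right hJ (mul_nonneg hA0 (Real.rpow_nonneg hr0.le _))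
        _ = A * R ^ (-θ) := by
            rw [hRr, hK₀_def, Real.mul_rpow hr0.le (by positivity : (0:ℝ) ≤ 2 ^ (J + 1))]; ring
  -- conclusion: every `R ≥ 1` lies below some `2^n K₀`
  refine ⟨A, θ, hθ34, fun R hR => ?_⟩
  obtain ⟨n, hn⟩ := pow_unbounded_of_one_lt R (by norm_num : (1:ℝ) < 2)
  exact claim n R hR (hn.trans_le (le_mul_of_one_le_right (by positivity) hK₀1))

end Summit.CriticalPhenomena.SAWScalingLimit.Theorems.DefectDecoherence.TipMartingale
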